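import Summits.Ventures.PercRepro.RankLevelSetBiIndepPerElem

/-! # RankLevelSetBiIndepPaving — EVERY PAVING MATROID SATISFIES THE PER-ELEMENT PROFILE INEQUALITY (★★)
(night-1 g25; dossier §37)

A matroid is PAVING when every subset of the ground set with fewer elements than the rank is independent
(`Paving M`; sparse paving matroids, uniform matroids and all matroids of rank ≤ 1 are paving). For such a matroid the
per-element inequality (★★) of `RankLevelSetBiIndepPerElem` — `#{Z ∈ D_j : y ∉ Z} ≤ #{Q ∈ D_{j+1} : y ∈ Q}` for
`2j + 1 < #E` — is witnessed by the plain map `Z ↦ Z ∪ {y}`: a bi-independent `j`-set `Z` has an INDEPENDENT complement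
of size `#E − j > j + 1`, so `j + 1 < rank` and `Z ∪ {y}` is independent by pavingness; its complement is a subset of
the independent set `E ∖ Z`. So the sparse-paving part of the census of dossier §36.5 (random sparse paving matroids
n ≤ 15) is a theorem, and with `biIndepMono_of_perElem` every paving matroid has the monotone profile and the global
level-wise theorems of §35.10 unconditionally.

* `Paving M` — the class (a `Prop`).
* `paving_indep_of_encard_lt`, `biIndep_compl_encard_le_eRank` — the two facts the map needs.
* **`biIndepPerElem_of_paving`**: `Paving M → BiIndepPerElem M`; **`biIndepMono_of_paving`**: the monotone form.
Every declaration has a docstring; imports: the cell's own modules and Mathlib only. Axioms: standard. -/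

namespace PercRepro

open Set Matroid

variable {α : Type} (M : Matroid α)

/-- **PAVING**: every subset of the ground set with fewer than `rank` elements is independent (equivalently, every
circuit has at least `rank` elements). Uniform and sparse paving matroids are paving. -/
def Paving : Prop := ∀ I ⊆ M.E, I.encard < M.eRank → M.Indep I

/-- In a paving matroid a subset of the ground set whose size is below the rank is independent. -/
lemma paving_indep_of_encard_lt (h : Paving M) {I : Set α} (hI : I ⊆ M.E) (hlt : I.encard < M.eRank) :
    M.Indep I := h I hI hlt

variable [M.Finite]

/-- The complement of a bi-independent `j`-set has `#E − j` elements and is independent, so `#E − j ≤ rank`. -/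
lemma biIndep_compl_encard_le_eRank {j : ℕ} {Z : Set α} (hZ : Z ∈ biIndep M j) :
    ((M.E.ncard - j : ℕ) : ℕ∞) ≤ M.eRank := by
  obtain ⟨hZE, hcard, -, hcind⟩ := hZ
  have h1 : (M.E \ Z).ncard = M.E.ncard - j := by
    rw [Set.ncard_sdiff' hZE M.ground_finite, hcard]
  have h2 : ((M.E \ Z).ncard : ℕ∞) = (M.E \ Z).encard :=
    Set.Finite.cast_ncard_eq (M.ground_finite.subset Set.sdiff_subset)
  rw [← h1, h2]
  exact hcind.encard_le_eRank

/-- **EVERY PAVING MATROID SATISFIES (★★)**: `Paving M → BiIndepPerElem M`. The injection is `Z ↦ Z ∪ {y}`. -/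
theorem biIndepPerElem_of_paving (h : Paving M) : BiIndepPerElem M := by
  intro y hy j hj
  classical
  have hEfin : M.E.Finite := M.ground_finite
  have hmaps : ∀ Z ∈ {Z ∈ biIndep M j | y ∉ Z}, insert y Z ∈ {Q ∈ biIndep M (j + 1) | y ∈ Q} := by
    intro Z hZ
    obtain ⟨hZbi, hyZ⟩ := hZ
    obtain ⟨hZE, hZcard, hZind, hZcind⟩ := hZbi
    have hZfin : Z.Finite := hEfin.subset hZE
    have hcard : (insert y Z).ncard = j + 1 := by
      rw [Set.ncard_insert_of_notMem hyZ hZfin, hZcard]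
    have hind : M.Indep (insert y Z) := by
      refine paving_indep_of_encard_lt M h (Set.insert_subset hy hZE) ?_
      have hle := biIndep_compl_encard_le_eRank M ⟨hZE, hZcard, hZind, hZcind⟩
      have hlt : ((j + 1 : ℕ) : ℕ∞) < ((M.E.ncard - j : ℕ) : ℕ∞) := by
        exact_mod_cast (by omega : j + 1 < M.E.ncard - j)
      rw [← Set.Finite.cast_ncard_eq (hZfin.insert y), hcard]
      exact lt_of_lt_of_le hlt hle
    refine ⟨⟨Set.insert_subset hy hZE, hcard, hind, ?_⟩, Set.mem_insert y Z⟩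
    exact hZcind.subset (Set.sdiff_subset_sdiff_right (Set.subset_insert y Z))
  have hinj : Set.InjOn (fun Z => insert y Z) {Z ∈ biIndep M j | y ∉ Z} := by
    intro Z hZ Z' hZ' hgg
    obtain ⟨-, hyZ⟩ := hZ
    obtain ⟨-, hyZ'⟩ := hZ'
    simp only at hgg
    ext x
    constructor
    · intro hx
      have h1 : x ∈ insert y Z' := by rw [← hgg]; exact Set.mem_insert_of_mem y hx
      rcases Set.mem_insert_iff.mp h1 with hxy | hx'
      · exact absurd (hxy ▸ hx) hyZ
      · exact hx'
    · intro hx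
      have h1 : x ∈ insert y Z := by rw [hgg]; exact Set.mem_insert_of_mem y hx
      rcases Set.mem_insert_iff.mp h1 with hxy | hx'
      · exact absurd (hxy ▸ hx) hyZ'
      · exact hx'
  exact Set.ncard_le_ncard_of_injOn (fun Z => insert y Z) hmaps hinj
    ((biIndep_finite M (j + 1)).subset (fun Q hQ => hQ.1))

/-- **Every paving matroid has the monotone profile** `(#E − j)·D_j ≤ (j + 1)·D_{j+1}` (and hence, through
`RankLevelSetBiIndepPerElem`, the global level-wise theorems of §35.10 unconditionally). -/
theorem biIndepMono_of_paving (h : Paving M) : BiIndepMono M :=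
  biIndepMono_of_perElem M (biIndepPerElem_of_paving M h)

end PercRepro
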